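import Mathlib
import Summits.NavierStokesRegularity.NavierStokesRegularity.Theorems.TaoLadderRungTwoFlatExistTubeLevels
import Summits.NavierStokesRegularity.NavierStokesRegularity.Theorems.TaoLadderRungTwoFlatShellShift
import HarnessLib

/-!
# K4, ALL HORIZONS: the a-priori bound past the landing (`s ∈ (c₀, c]`) by discrete scale covariance — the continuation of a hop flow past its
  section time is a flow from the RE-CENTRED state, to which the next hop's a-priori bound applies
  (helper for the K_A♭ parent item stmt-NavierStokesRegularity-22987 `FlatGapCertificatesV2`, child 2A `GradedAdiabaticWakeA` of route
  TaoLadderRungTwoFlat; cell harvest/h2-tao-ladder, p1 g25; LADDER §47.5 L2, §50 (`TubeExist`, K4))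

`apriori_capture_of_continuity` / `apriori_tube_of_levels` bound every exact flow from a ball state on horizons `s ≤ c₀`. The format's clock
window is `[0, c]` with `c > c₀`. For `s ∈ (c₀, c]` a flow `S` on `[0, s]` IS a hop premise (`τ = s ≥ c₀`), so the hop obligations give its
landing: `τ₁ ∈ [t_lo, c₀]`, ratio `a ∈ [f, a_max]`, `y = recentre S τ₁ a ∈ H(n+1)`. The continuation `t ∈ [τ₁, s]` reads
`S_{i,k}(t) = a·Y_{i,k−1}((t − τ₁)·a·(1+ε₀)^{5/2})` with `Y := scaleFam (1/a) ∘ shellShift ∘ translateFam τ₁` of `S` an exact flow FROM `y`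
(`FlowSymmetry.pseudoFlowOnShift_translate`, `pseudoFlowOnShift_shellShift`, `FlowSymmetry.pseudoFlowOnShift_scale`) on a horizon
`≤ (c − t_lo)·a_max·(1+ε₀)^{5/2} ≤ c₀`; the next hop's a-priori bound — UNIFORM over tube states with behind cap `≤ Λ̄` and `ω`-bound `≤ B̄_z`,
both read off the current hop's bound `B` (`Λ̄ = B/(ω_min f)`, `B̄_z = Λ_ω B/f`) — then bounds `ω|S|` on `[τ₁, s]`.

* `pseudoFlowOnShift_continuation` — the continuation past `τ₁` as an exact flow from `recentre S τ₁ a`;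
* `apriori_tube_uniform` — `apriori_tube_of_levels` with the per-state inputs (behind cap, `ω`-bound of the tube state) as uniform PARAMETERS
  (the bound depends on `(Λ̄, B̄_z)` only);
* `apriori_extend_of_landing` — **the `hapr` clause of `tubeExistWith_of_apriori` at hop `n` for ALL `s ≤ c`**, from the short-horizon bound at
  hop `n`, the landing data, and the uniform short-horizon bound at hop `n + 1`.

HONEST FRAMING: soft analysis over the cell's typed induction frame (MODEL lattice, graded mirror table on `S♭`); landing data, levels and
weights are HYPOTHESES; nothing certified; no item closed; nothing about the Navier–Stokes equations.
-/

noncomputable section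

-- the sub-problem namespace repeats the summit name by design (D-0017)
set_option linter.dupNamespace false

namespace Summit.NavierStokesRegularity.NavierStokesRegularity.Theorems.HopTube

open Set Finset Filter Topology Literature.Analysis.FluidPDE Literature.Analysis.FluidPDE.TaoCascade MirrorPulse RenormFrame QuadPolar
  GappedFrontRobustOn FlowSymmetry

variable {ε ε₀ : ℝ}

/-- **The continuation of an exact flow past a checkpoint is an exact flow from the re-centred state**: for `S` exact on `[0, s]` from `S₀`,
`0 ≤ τ₁ < s`, `a > 0`, the family `(i, k, u) ↦ S_{i,k+1}(τ₁ + λu/a)/a`, `λ = (1+ε₀)^{−5/2}`, is an exact zero-slack flow on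
`[0, (s − τ₁)·a/λ]` from `recentre S τ₁ a`. [cite: Tao2016AveragedNS, §4 (4.8) (autonomy, homogeneity, discrete scale invariance), §6.4 (re-centring); route TaoLadderRungTwoFlat, K4] -/
theorem pseudoFlowOnShift_continuation {s τ₁ a : ℝ} {S₀ : Fin 2 → ℤ → ℝ} {S F : Fin 2 → ℤ → ℝ → ℝ}
    (hS : PseudoFlowOnShift shiftSetFlat s ε₀ (mirrorTable ε ε) 0 0 S₀ (fun i k => (1 / 2) * S₀ i k ^ 2) (fun _ _ => 0) S F)
    (hε₀ : 0 ≤ ε₀) (hτ₁ : 0 ≤ τ₁) (hτ₁s : τ₁ < s) (ha : 0 < a) :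
    PseudoFlowOnShift shiftSetFlat ((s - τ₁) / (1 + ε₀) ^ (-(5 : ℝ) / 2) / a⁻¹) ε₀ (mirrorTable ε ε) 0 0 (recentre S τ₁ a)
      (fun i k => (1 / 2) * recentre S τ₁ a i k ^ 2) (fun _ _ => 0)
      (scaleFam a⁻¹ (fun i k u => translateFam τ₁ S i (k + 1) ((1 + ε₀) ^ (-(5 : ℝ) / 2) * u)))
      (fun i k t => (1 / 2) * scaleFam a⁻¹ (fun i k u => translateFam τ₁ S i (k + 1) ((1 + ε₀) ^ (-(5 : ℝ) / 2) * u)) i k t ^ 2) := by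
  have hε : 0 ≤ 1 + ε₀ := by linarith
  have h1 := pseudoFlowOnShift_translate hε hS hτ₁ hτ₁s
  have h2 := pseudoFlowOnShift_shellShift hε₀ (sub_pos.mpr hτ₁s) h1
  have h3 := pseudoFlowOnShift_scale hε (div_pos (sub_pos.mpr hτ₁s) (Real.rpow_pos_of_pos (by linarith) _)) h2 (inv_pos.mpr ha)
  have e1 : (fun i k => a⁻¹ * translateFam τ₁ S i (k + 1) ((1 + ε₀) ^ (-(5 : ℝ) / 2) * 0)) = recentre S τ₁ a := by
    funext i k
    simp only [translateFam, recentre, mul_zero, add_zero, add_comm k 1, div_eq_inv_mul]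
  have e2 : (fun i k => (1 / 2 : ℝ) * (a⁻¹ * translateFam τ₁ S i (k + 1) ((1 + ε₀) ^ (-(5 : ℝ) / 2) * 0)) ^ 2)
      = fun i k => (1 / 2) * recentre S τ₁ a i k ^ 2 := by
    funext i k
    simp only [translateFam, recentre, mul_zero, add_zero, add_comm k 1, div_eq_inv_mul]
  -- the shifted start state of `h2` is `fun i k => translateFam τ₁ S i (k+1) 0`; `h3` scales it
  have h3' : PseudoFlowOnShift shiftSetFlat ((s - τ₁) / (1 + ε₀) ^ (-(5 : ℝ) / 2) / a⁻¹) ε₀ (mirrorTable ε ε) 0 0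
      (fun i k => a⁻¹ * translateFam τ₁ S i (k + 1) ((1 + ε₀) ^ (-(5 : ℝ) / 2) * 0))
      (fun i k => (1 / 2) * (a⁻¹ * translateFam τ₁ S i (k + 1) ((1 + ε₀) ^ (-(5 : ℝ) / 2) * 0)) ^ 2) (fun _ _ => 0)
      (scaleFam a⁻¹ (fun i k u => translateFam τ₁ S i (k + 1) ((1 + ε₀) ^ (-(5 : ℝ) / 2) * u)))
      (fun i k t => (1 / 2) * scaleFam a⁻¹ (fun i k u => translateFam τ₁ S i (k + 1) ((1 + ε₀) ^ (-(5 : ℝ) / 2) * u)) i k t ^ 2) := by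
    convert h3 using 3 <;> simp [translateFam]
  rw [e1, e2] at h3'
  exact h3'

section Uniform

/-- **K4 AT A TUBE HOP (horizons `s ≤ c₀`), UNIFORM FORM**: as `apriori_tube_of_levels`, with the per-state inputs (behind cap `Λ̄`, `ω`-bound
`B̄_z` of the tube state) as PARAMETERS, so that ONE bound serves every tube state below those caps (needed one hop upstream, where the state is
the landing of an arbitrary flow).
[cite: Tao2016AveragedNS, §4 Lemma 4.1 (4.5), (4.8), §5, §6.2 Prop. 6.3 (ix); route TaoLadderRungTwoFlat, `HopTube.TubeExistWith` (cell LADDER §47.5 L2, K4; §54; §62)] -/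
theorem apriori_tube_uniform (P : TubeSchedule) {Bcl : ℕ → (Fin 2 → ℤ → ℝ) → Prop} {i₀ : Fin 2} {X₀ : Fin 2 → ℝ}
    {w ω : ℤ → ℝ} {r c₀ : ℝ} {ζ : ℕ → Fin 2 → ℤ → ℝ} {ustar : Fin 2 → ℤ → ℝ} {n : ℕ}
    (hε : 0 ≤ ε) (hε₀ : 0 < ε₀) (hc₀ : 0 < c₀) (hn : P.N₀ < n) (hr0 : 0 ≤ r) (hw1 : ∀ k, 1 ≤ w k)
    -- the Banach weight: nonnegative, dominated by `Ω_w·w`, bounded by `Ω_b` behind the window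
    {Ωw Ωb : ℝ} (hω0 : ∀ k, 0 ≤ ω k) (hΩw : 0 ≤ Ωw) (hωw : ∀ k, ω k ≤ Ωw * w k) (hΩb : 0 ≤ Ωb)
    (hωb : ∀ k, k < -(P.K : ℤ) → ω k ≤ Ωb)
    -- uniform caps: behind cap `Λ̄ ≥ 0` and `ω`-bound `B̄_z` of the tube states considered
    {Λ Bz : ℝ} (hΛ0 : 0 ≤ Λ)
    -- ZONE LEVELS along every exact flow from a ball state on `[0, s]`, `s ≤ c₀`
    {Hk Hb : ℤ → ℝ} {Cb θb' BH : ℝ} {kH : ℤ} (hKH : -(P.K : ℤ) ≤ kH + 1)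
    (hlev : ∀ z S₀ s S F, InTubeWith P Bcl i₀ X₀ w r ζ ustar n z → (∀ i k, w k * |S₀ i k - z i k| ≤ r) → 0 < s → s ≤ c₀ →
      PseudoFlowOnShift shiftSetFlat s ε₀ (mirrorTable ε ε) 0 0 S₀ (fun i k => (1 / 2) * S₀ i k ^ 2) (fun _ _ => 0) S F →
        ∀ t ∈ Icc 0 s, ∀ (i : Fin 2) (k : ℤ),
          (k < -(P.K : ℤ) → |S i k t| ≤ Hb k) ∧ (-(P.K : ℤ) ≤ k → k ≤ kH + 1 → |S i k t| ≤ Hk k))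
    (hCb : 0 ≤ Cb) (hθb0 : 0 ≤ θb') (hθb : θb' < 5 / 2 * Real.log (1 + ε₀))
    (hHb : ∀ k : ℤ, k < -(P.K : ℤ) → Hb k ≤ Cb * Real.exp (θb' * (-(P.K : ℝ) - k)))
    (hHω : ∀ k : ℤ, -(P.K : ℤ) ≤ k → k ≤ kH + 1 → ω k * Hk k ≤ BH)
    -- AHEAD: the cut schedule (rows at horizon `c₀`), window-top hull `Hk (k_H+1) ≤ Vtop`, `ω·2G ≤ B_G` beyond
    {Vtop BG : ℝ} {G Ω : ℤ → ℝ} (hk₁H : (P.k₁ : ℤ) ≤ kH + 2) (hVtop : 0 ≤ Vtop) (hHV : Hk (kH + 1) ≤ Vtop)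
    (hG0 : ∀ j, kH < j → 0 ≤ G j)
    (hΩ : ∀ j, kH < j → ∀ N : Finset ℤ, (∀ m ∈ N, j < m) → ∑ m ∈ N, (w m)⁻¹ ^ 2 ≤ Ω j)
    (hGΩ : ∀ j, kH < j → 2 * (9 / 8 * r) ^ 2 * Ω j ≤ G j ^ 2)
    (hclose0 : 4 / 3 * c₀ * clock ε₀ (kH + 1) * Vtop * (Vtop + 2 * ε * G (kH + 1)) < G (kH + 1))
    (hcloseG : ∀ j, kH + 1 ≤ j →
      4 / 3 * c₀ * clock ε₀ (j + 1) * (2 * G j) * (2 * G j + 2 * ε * G (j + 1)) < G (j + 1))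
    (hGω : ∀ k : ℤ, kH + 1 < k → ω k * (2 * G (k - 1)) ≤ BG)
    : ∃ B : ℝ, ∀ z S₀ : Fin 2 → ℤ → ℝ, InTubeWith P Bcl i₀ X₀ w r ζ ustar n z →
      (∀ (i : Fin 2) (k : ℤ), k < -(P.K : ℤ) → |z i k| ≤ Λ) → (∀ i k, ω k * |z i k| ≤ Bz) → (∀ i k, w k * |S₀ i k - z i k| ≤ r) →
      (∀ (i : Fin 2) (k : ℤ), ω k * |S₀ i k| ≤ B) ∧
        ∀ s : ℝ, 0 < s → s ≤ c₀ → ∀ S F : Fin 2 → ℤ → ℝ → ℝ,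
          PseudoFlowOnShift shiftSetFlat s ε₀ (mirrorTable ε ε) 0 0 S₀ (fun i k => (1 / 2) * S₀ i k ^ 2) (fun _ _ => 0) S F →
            ∀ t ∈ Icc 0 s, ∀ (i : Fin 2) (k : ℤ), ω k * |S i k t| ≤ B := by
  have hε' : (-1 : ℝ) < ε₀ := by linarith
  have hcpos : ∀ k, 0 < clockW ε₀ k := clockW_pos hε'
  have hw0 : ∀ k, 0 < w k := fun k => lt_of_lt_of_le one_pos (hw1 k)
  have hT0 : 0 ≤ tableAbsSum shiftSetFlat (mirrorTable ε ε) := tableAbsSum_nonneg _ _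
  -- the deep shell
  obtain ⟨kstar, hkstar, hdeep⟩ := exists_deep_shell (A := 8 * c₀ * tableAbsSum shiftSetFlat (mirrorTable ε ε)) hε₀ hθb0 hθb
    (by positivity) (by positivity : 0 ≤ Λ + r) hCb P.K (-(P.K : ℤ) - 2)
  set Λ₁ : ℝ := Λ + r + Cb * Real.exp (θb' * (-(P.K : ℝ) - kstar - 1)) + 1 with hΛ₁
  have hE0 : 0 ≤ Cb * Real.exp (θb' * (-(P.K : ℝ) - kstar - 1)) := mul_nonneg hCb (Real.exp_pos _).le
  have hΛ₁0 : 0 < Λ₁ := by rw [hΛ₁]; linarith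
  -- the bound
  set B : ℝ := 2 * Ωb * Λ₁ + |BH| + |BG| + (|Bz| + Ωw * r) with hB
  have hB1 : 2 * Ωb * Λ₁ ≤ B := by rw [hB]; have := abs_nonneg BH; have := abs_nonneg BG; have := abs_nonneg Bz; nlinarith
  have hB2 : BH ≤ B := by rw [hB]; have := le_abs_self BH; have := abs_nonneg BG; have := abs_nonneg Bz; nlinarith
  have hB3 : BG ≤ B := by rw [hB]; have := le_abs_self BG; have := abs_nonneg BH; have := abs_nonneg Bz; nlinarith
  have hB4 : Bz + Ωw * r ≤ B := by rw [hB]; have := le_abs_self Bz; have := abs_nonneg BH; have := abs_nonneg BG; nlinarith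
  refine ⟨B, fun z S₀ hz hΛ hBz hkick => ?_⟩
  -- the ball state: `ω|S₀| ≤ Bz + Ω_w r`, and `|S₀| ≤ Λ + r` behind the window
  have hkick' : ∀ i k, |S₀ i k - z i k| ≤ r / w k := fun i k => by
    rw [le_div_iff₀ (hw0 k), mul_comm]; exact hkick i k
  have hS₀ω : ∀ (i : Fin 2) (k : ℤ), ω k * |S₀ i k| ≤ Bz + Ωw * r := by
    intro i k
    have htri : |S₀ i k| ≤ |z i k| + |S₀ i k - z i k| := by
      have := abs_add_le (z i k) (S₀ i k - z i k); simp only [add_sub_cancel] at this; exact this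
    have hωr : ω k * (r / w k) ≤ Ωw * r := by
      calc ω k * (r / w k) ≤ Ωw * w k * (r / w k) := mul_le_mul_of_nonneg_right (hωw k) (div_nonneg hr0 (hw0 k).le)
        _ = Ωw * (w k * r / w k) := by ring
        _ = Ωw * r := by rw [mul_div_cancel_left₀ r (hw0 k).ne']
    calc ω k * |S₀ i k| ≤ ω k * (|z i k| + |S₀ i k - z i k|) := mul_le_mul_of_nonneg_left htri (hω0 k)
      _ ≤ ω k * |z i k| + ω k * (r / w k) := by rw [mul_add]; exact add_le_add le_rfl (mul_le_mul_of_nonneg_left (hkick' i k) (hω0 k))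
      _ ≤ Bz + Ωw * r := add_le_add (hBz i k) hωr
  have hS₀b : ∀ (i : Fin 2) (k : ℤ), k < -(P.K : ℤ) → |S₀ i k| ≤ Λ + r := by
    intro i k hk
    have htri : |S₀ i k| ≤ |z i k| + |S₀ i k - z i k| := by
      have := abs_add_le (z i k) (S₀ i k - z i k); simp only [add_sub_cancel] at this; exact this
    have : r / w k ≤ r := div_le_self hr0 (hw1 k)
    linarith [hΛ i k hk, hkick' i k]
  refine ⟨fun i k => (hS₀ω i k).trans hB4, fun s hs hsc S F hS t ht i k => ?_⟩
  -- levels along this flow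
  have hlevS := hlev z S₀ s S F hz hkick hs hsc hS
  rcases lt_or_ge k (-(P.K : ℤ)) with hkB | hkB
  · -- behind the window: frozen below `k⋆`, exponential levels above
    have hbound : |S i k t| ≤ 2 * Λ₁ := by
      rcases le_or_gt k kstar with hkd | hkd
      · -- deep: frozen
        refine deepBehind_plain_sup isNearestNeighbourSet_shiftSetFlat hS hε₀ hΛ₁0 (kstar := kstar) ?_ ?_ ?_ i k hkd t ht
        · intro j k' hk'
          have := hS₀b j k' (by omega)
          rw [hΛ₁]; linarith
        · intro j u hu
          have h1 := (hlevS u hu j (kstar + 1)).1 (by omega)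
          have h2 := hHb (kstar + 1) (by omega)
          have e : (-(P.K : ℝ) - ((kstar + 1 : ℤ) : ℝ)) = -(P.K : ℝ) - kstar - 1 := by push_cast; ring
          rw [e] at h2
          rw [hΛ₁]; linarith
        · calc 8 * s * tableAbsSum shiftSetFlat (mirrorTable ε ε) * clockW ε₀ kstar * Λ₁
              ≤ 8 * c₀ * tableAbsSum shiftSetFlat (mirrorTable ε ε) * clockW ε₀ kstar * Λ₁ := by
                have := (hcpos kstar).le
                apply mul_le_mul_of_nonneg_right _ hΛ₁0.le
                apply mul_le_mul_of_nonneg_right _ this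
                nlinarith
            _ = 8 * c₀ * tableAbsSum shiftSetFlat (mirrorTable ε ε) * clockW ε₀ kstar
                * (Λ + r + Cb * Real.exp (θb' * (-(P.K : ℝ) - kstar - 1)) + 1) := by rw [hΛ₁]
            _ ≤ 1 := hdeep
      · -- between `k⋆` and the window bottom: the exponential levels, dominated by the one at `k⋆ + 1`
        have h1 := (hlevS t ht i k).1 hkB
        have h2 := hHb k hkB
        have hmono : Real.exp (θb' * (-(P.K : ℝ) - k)) ≤ Real.exp (θb' * (-(P.K : ℝ) - kstar - 1)) := by
          apply Real.exp_le_exp.mpr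
          have : ((kstar + 1 : ℤ) : ℝ) ≤ k := by exact_mod_cast hkd
          push_cast at this
          nlinarith
        have h3 : Cb * Real.exp (θb' * (-(P.K : ℝ) - k)) ≤ Cb * Real.exp (θb' * (-(P.K : ℝ) - kstar - 1)) :=
          mul_le_mul_of_nonneg_left hmono hCb
        rw [hΛ₁]; linarith
    calc ω k * |S i k t| ≤ Ωb * (2 * Λ₁) := mul_le_mul (hωb k hkB) hbound (abs_nonneg _) hΩb
      _ = 2 * Ωb * Λ₁ := by ring
      _ ≤ B := hB1
  rcases le_or_gt k (kH + 1) with hkW | hkW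
  · -- the window: hull levels
    have h1 := (hlevS t ht i k).2 hkB hkW
    calc ω k * |S i k t| ≤ ω k * Hk k := mul_le_mul_of_nonneg_left h1 (hω0 k)
      _ ≤ BH := hHω k hkB hkW
      _ ≤ B := hB2
  · -- ahead: the cut schedule at horizon `s`
    have hVt : ∀ z' S₀' τ' S' F', HopPremiseWith P Bcl shiftSetFlat ε₀ i₀ (mirrorTable ε ε) X₀ w r s ζ ustar n z' S₀' τ' S' F' →
        ∀ u ∈ Icc 0 s, |S' 1 (kH + 1) u| ≤ Vtop := by
      intro z' S₀' τ' S' F' hprem u hu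
      obtain ⟨hz', hkick'', hsτ, hflow⟩ := hprem
      have hflow' := pseudoFlowOnShift_mono hflow hs hsτ
      exact (((hlev z' S₀' s S' F' hz' hkick'' hs hsc hflow' u hu 1 (kH + 1)).2 hKH le_rfl).trans hHV)
    have hinit := initialTails_of_premise_slot (ε := ε) (ε₀ := ε₀) (Bcl := Bcl) (i₀ := i₀) (X₀ := X₀) (c₀ := s) (ζ := ζ)
      (ustar := ustar) P hn hw0 hr0 hk₁H hΩ hGΩ
    have hmono4 : ∀ (X : ℝ), 0 ≤ X → 4 / 3 * s * X ≤ 4 / 3 * c₀ * X := fun X hX =>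
      mul_le_mul_of_nonneg_right (by linarith) hX
    have hclose0' : 4 / 3 * s * clock ε₀ (kH + 1) * Vtop * (Vtop + 2 * ε * G (kH + 1)) < G (kH + 1) := by
      have hX : 0 ≤ clock ε₀ (kH + 1) * Vtop * (Vtop + 2 * ε * G (kH + 1)) := by
        have := clock_nonneg hε'.le (kH + 1); have := hG0 (kH + 1) (by omega); positivity
      have h1 := hmono4 _ hX
      calc 4 / 3 * s * clock ε₀ (kH + 1) * Vtop * (Vtop + 2 * ε * G (kH + 1))
          = 4 / 3 * s * (clock ε₀ (kH + 1) * Vtop * (Vtop + 2 * ε * G (kH + 1))) := by ring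
        _ ≤ 4 / 3 * c₀ * (clock ε₀ (kH + 1) * Vtop * (Vtop + 2 * ε * G (kH + 1))) := h1
        _ = 4 / 3 * c₀ * clock ε₀ (kH + 1) * Vtop * (Vtop + 2 * ε * G (kH + 1)) := by ring
        _ < G (kH + 1) := hclose0
    have hcloseG' : ∀ j, kH + 1 ≤ j → 4 / 3 * s * clock ε₀ (j + 1) * (2 * G j) * (2 * G j + 2 * ε * G (j + 1)) < G (j + 1) := by
      intro j hj
      have hX : 0 ≤ clock ε₀ (j + 1) * (2 * G j) * (2 * G j + 2 * ε * G (j + 1)) := by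
        have := clock_nonneg hε'.le (j + 1); have := hG0 j (by omega); have := hG0 (j + 1) (by omega); positivity
      have h1 := hmono4 _ hX
      calc 4 / 3 * s * clock ε₀ (j + 1) * (2 * G j) * (2 * G j + 2 * ε * G (j + 1))
          = 4 / 3 * s * (clock ε₀ (j + 1) * (2 * G j) * (2 * G j + 2 * ε * G (j + 1))) := by ring
        _ ≤ 4 / 3 * c₀ * (clock ε₀ (j + 1) * (2 * G j) * (2 * G j + 2 * ε * G (j + 1))) := h1
        _ = 4 / 3 * c₀ * clock ε₀ (j + 1) * (2 * G j) * (2 * G j + 2 * ε * G (j + 1)) := by ring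
        _ < G (j + 1) := hcloseG j hj
    have hcuts := aheadCuts_of_schedule (P := P) (Bcl := Bcl) (i₀ := i₀) (X₀ := X₀) (w := w) (r := r) (c₀ := s) (ζ := ζ)
      (ustar := ustar) (n := n) hε hε₀ hs.le hVtop hG0 hVt hinit hclose0' hcloseG'
    have hprem : HopPremiseWith P Bcl shiftSetFlat ε₀ i₀ (mirrorTable ε ε) X₀ w r s ζ ustar n z S₀ s S F := ⟨hz, hkick, le_rfl, hS⟩
    have h1 : |S i k t| ≤ 2 * G (k - 1) := hcuts (k - 1) (by omega) z S₀ s S F hprem t ht i k (by omega)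
    calc ω k * |S i k t| ≤ ω k * (2 * G (k - 1)) := mul_le_mul_of_nonneg_left h1 (hω0 k)
      _ ≤ BG := hGω k hkW
      _ ≤ B := hB3

end Uniform

section Extend

/-- **K4, ALL HORIZONS AT HOP `n`: the a-priori `ω`-bound up to the clock window `c` from the short-horizon bound, the landing data and the
next hop's uniform short-horizon bound.** See the module docstring. Output: the `hapr` clause of `tubeExistWith_of_apriori` at hop `n`.
[cite: Tao2016AveragedNS, §4 Lemma 4.1 (4.5), (4.8), (4.12), §6.4 (re-centring; the rescaled system); route TaoLadderRungTwoFlat, `HopTube.TubeExistWith` (cell LADDER §47.5 L2, K4)] -/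
theorem apriori_extend_of_landing (P : TubeSchedule) {Bcl : ℕ → (Fin 2 → ℤ → ℝ) → Prop} {rule : HopRule} {i₀ : Fin 2}
    {X₀ : Fin 2 → ℝ} {w ω : ℤ → ℝ} {r c₀ c : ℝ} {ζ : ℕ → Fin 2 → ℤ → ℝ} {ustar : Fin 2 → ℤ → ℝ} {n : ℕ}
    (hε₀ : 0 < ε₀) (hc₀ : 0 < c₀)
    {f amax tlo ωmin Λω : ℝ} (hf : 0 < f) (hamax : 0 < amax) (htlo : 0 < tlo)
    (hcrange : (c - tlo) * amax * (1 + ε₀) ^ ((5 : ℝ) / 2) ≤ c₀)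
    (hω0 : ∀ k, 0 ≤ ω k) (hωmin0 : 0 < ωmin) (hωmin : ∀ k : ℤ, k ≤ -(P.K : ℤ) → ωmin ≤ ω k)
    (hΛω : 0 ≤ Λω) (hωdown : ∀ k : ℤ, ω k ≤ Λω * ω (k + 1)) (hωup : ∀ k : ℤ, ω k ≤ Λω * ω (k - 1))
    -- the short-horizon bound at hop `n` (per state)
    (hshort : ∀ z S₀ : Fin 2 → ℤ → ℝ, InTubeWith P Bcl i₀ X₀ w r ζ ustar n z → (∀ i k, w k * |S₀ i k - z i k| ≤ r) →
      ∃ B : ℝ, (∀ (i : Fin 2) (k : ℤ), ω k * |S₀ i k| ≤ B) ∧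
        ∀ s : ℝ, 0 < s → s ≤ c₀ → ∀ S F : Fin 2 → ℤ → ℝ → ℝ,
          PseudoFlowOnShift shiftSetFlat s ε₀ (mirrorTable ε ε) 0 0 S₀ (fun i k => (1 / 2) * S₀ i k ^ 2) (fun _ _ => 0) S F →
            ∀ t ∈ Icc 0 s, ∀ (i : Fin 2) (k : ℤ), ω k * |S i k t| ≤ B)
    -- the landing data at hop `n` (clock window, ratio range, landing in `H(n+1)`)
    (hland : ∀ z S₀ τ S F, HopPremiseWith P Bcl shiftSetFlat ε₀ i₀ (mirrorTable ε ε) X₀ w r c₀ ζ ustar n z S₀ τ S F →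
      tlo ≤ rule.τ₁ n S ∧ rule.τ₁ n S ≤ c₀ ∧ f ≤ rule.a n S ∧ rule.a n S ≤ amax ∧
        InTubeWith P Bcl i₀ X₀ w r ζ ustar (n + 1) (recentre S (rule.τ₁ n S) (rule.a n S)))
    -- the UNIFORM short-horizon bound at hop `n + 1` (states below the caps `Λ̄`, `B̄_z`; no kick)
    (hnext : ∀ Λb Bz : ℝ, 0 ≤ Λb → ∃ B' : ℝ, ∀ y : Fin 2 → ℤ → ℝ, InTubeWith P Bcl i₀ X₀ w r ζ ustar (n + 1) y →
      (∀ (i : Fin 2) (k : ℤ), k < -(P.K : ℤ) → |y i k| ≤ Λb) → (∀ (i : Fin 2) (k : ℤ), ω k * |y i k| ≤ Bz) →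
        ∀ s' : ℝ, 0 < s' → s' ≤ c₀ → ∀ Y FY : Fin 2 → ℤ → ℝ → ℝ,
          PseudoFlowOnShift shiftSetFlat s' ε₀ (mirrorTable ε ε) 0 0 y (fun i k => (1 / 2) * y i k ^ 2) (fun _ _ => 0) Y FY →
            ∀ u ∈ Icc 0 s', ∀ (i : Fin 2) (k : ℤ), ω k * |Y i k u| ≤ B')
    {z S₀ : Fin 2 → ℤ → ℝ} (hz : InTubeWith P Bcl i₀ X₀ w r ζ ustar n z) (hkick : ∀ i k, w k * |S₀ i k - z i k| ≤ r) :
    ∃ B : ℝ, (∀ (i : Fin 2) (k : ℤ), ω k * |S₀ i k| ≤ B) ∧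
      ∀ s : ℝ, 0 < s → s ≤ c → ∀ S F : Fin 2 → ℤ → ℝ → ℝ,
        PseudoFlowOnShift shiftSetFlat s ε₀ (mirrorTable ε ε) 0 0 S₀ (fun i k => (1 / 2) * S₀ i k ^ 2) (fun _ _ => 0) S F →
          ∀ t ∈ Icc 0 s, ∀ (i : Fin 2) (k : ℤ), ω k * |S i k t| ≤ B := by
  have hq : 0 < 1 + ε₀ := by linarith
  set lam : ℝ := (1 + ε₀) ^ (-(5 : ℝ) / 2) with hlam
  have hlam0 : 0 < lam := Real.rpow_pos_of_pos hq _
  have hlaminv : lam⁻¹ = (1 + ε₀) ^ ((5 : ℝ) / 2) := by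
    rw [hlam, ← Real.rpow_neg hq.le]; norm_num
  obtain ⟨B, hB₀, hB⟩ := hshort z S₀ hz hkick
  have hBnn : 0 ≤ B := le_trans (mul_nonneg (hω0 0) (abs_nonneg _)) (hB₀ 0 0)
  set Λb : ℝ := B / (ωmin * f) with hΛb
  set Bz : ℝ := Λω * B / f with hBz
  obtain ⟨B', hB'⟩ := hnext Λb Bz (by positivity)
  set Bf : ℝ := B + amax * Λω * |B'| with hBf
  have hBf1 : B ≤ Bf := by rw [hBf]; have : 0 ≤ amax * Λω * |B'| := by positivity
                           linarith
  have hBf2 : amax * Λω * B' ≤ Bf := by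
    rw [hBf]
    have : amax * Λω * B' ≤ amax * Λω * |B'| := mul_le_mul_of_nonneg_left (le_abs_self _) (by positivity)
    linarith
  refine ⟨Bf, fun i k => (hB₀ i k).trans hBf1, fun s hs hsc S F hS t ht i k => ?_⟩
  rcases le_or_gt s c₀ with hsc₀ | hsc₀
  · exact (hB s hs hsc₀ S F hS t ht i k).trans hBf1
  -- `s > c₀`: the flow is a hop premise; its landing and the continuation
  have hprem : HopPremiseWith P Bcl shiftSetFlat ε₀ i₀ (mirrorTable ε ε) X₀ w r c₀ ζ ustar n z S₀ s S F := ⟨hz, hkick, hsc₀.le, hS⟩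
  obtain ⟨hτlo, hτc₀, hfa, haamax, hy⟩ := hland z S₀ s S F hprem
  set τ₁ := rule.τ₁ n S with hτ₁
  set a := rule.a n S with ha_def
  have ha : 0 < a := hf.trans_le hfa
  have hτ₁0 : 0 ≤ τ₁ := htlo.le.trans hτlo
  -- the bound `B` on `[0, c₀]`
  have hBc₀ : ∀ u ∈ Icc 0 c₀, ∀ (j : Fin 2) (m : ℤ), ω m * |S j m u| ≤ B :=
    hB c₀ hc₀ le_rfl S F (pseudoFlowOnShift_mono hS hc₀ hsc₀.le)
  rcases le_or_gt t c₀ with htc₀ | htc₀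
  · exact (hBc₀ t ⟨ht.1, htc₀⟩ i k).trans hBf1
  -- `t > c₀ ≥ τ₁`: the continuation from the re-centred state
  have hcont := pseudoFlowOnShift_continuation hS hε₀.le hτ₁0 (hτc₀.trans_lt hsc₀) ha
  set s' : ℝ := (s - τ₁) / lam / a⁻¹ with hs'
  have hs'pos : 0 < s' := by rw [hs']; exact div_pos (div_pos (by linarith) hlam0) (inv_pos.mpr ha)
  have hs'eq : s' = (s - τ₁) * a * (1 + ε₀) ^ ((5 : ℝ) / 2) := by
    rw [hs', ← hlaminv]; field_simp
  have hs'c₀ : s' ≤ c₀ := by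
    rw [hs'eq]
    have h1 : (s - τ₁) * a ≤ (c - tlo) * amax := by
      have : s - τ₁ ≤ c - tlo := by linarith
      exact mul_le_mul this haamax ha.le (by linarith)
    have h2 : 0 ≤ (1 + ε₀) ^ ((5 : ℝ) / 2) := Real.rpow_nonneg hq.le _
    exact (mul_le_mul_of_nonneg_right h1 h2).trans hcrange
  -- caps of the landing state from the bound `B` at time `τ₁`
  have hτ₁I : τ₁ ∈ Icc 0 c₀ := ⟨hτ₁0, hτc₀⟩
  have hcapy : ∀ (j : Fin 2) (m : ℤ), m < -(P.K : ℤ) → |recentre S τ₁ a j m| ≤ Λb := by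
    intro j m hm
    have hω1 : ωmin ≤ ω (1 + m) := hωmin (1 + m) (by omega)
    have hb := hBc₀ τ₁ hτ₁I j (1 + m)
    have h1 : |S j (1 + m) τ₁| ≤ B / ωmin := by
      rw [le_div_iff₀ hωmin0]
      calc |S j (1 + m) τ₁| * ωmin ≤ |S j (1 + m) τ₁| * ω (1 + m) := mul_le_mul_of_nonneg_left hω1 (abs_nonneg _)
        _ ≤ B := by rw [mul_comm]; exact hb
    simp only [recentre, abs_div, abs_of_pos ha]
    rw [hΛb, div_le_iff₀ ha]
    calc |S j (1 + m) τ₁| ≤ B / ωmin := h1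
      _ = B / (ωmin * f) * f := by field_simp
      _ ≤ B / (ωmin * f) * a := mul_le_mul_of_nonneg_left hfa (by positivity)
  have hωy : ∀ (j : Fin 2) (m : ℤ), ω m * |recentre S τ₁ a j m| ≤ Bz := by
    intro j m
    have hb := hBc₀ τ₁ hτ₁I j (1 + m)
    simp only [recentre, abs_div, abs_of_pos ha]
    have h1 : ω m * |S j (1 + m) τ₁| ≤ Λω * B := by
      calc ω m * |S j (1 + m) τ₁| ≤ Λω * ω (m + 1) * |S j (1 + m) τ₁| := mul_le_mul_of_nonneg_right (hωdown m) (abs_nonneg _)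
        _ = Λω * (ω (1 + m) * |S j (1 + m) τ₁|) := by rw [add_comm m 1]; ring
        _ ≤ Λω * B := mul_le_mul_of_nonneg_left hb hΛω
    calc ω m * (|S j (1 + m) τ₁| / a) ≤ ω m * (|S j (1 + m) τ₁| / f) :=
          mul_le_mul_of_nonneg_left (div_le_div_of_nonneg_left (abs_nonneg _) hf hfa) (hω0 m)
      _ = ω m * |S j (1 + m) τ₁| / f := by ring
      _ ≤ Λω * B / f := div_le_div_of_nonneg_right h1 hf.le
      _ = Bz := by rw [hBz]
  have hY := hB' (recentre S τ₁ a) hy hcapy hωy s' hs'pos hs'c₀ _ _ (by rw [hs']; exact hcont)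
  -- read the original flow off the continuation: `S_{i,k}(t) = a·Y_{i,k−1}(u)`, `u = ((t − τ₁)/λ)/a⁻¹`
  set u : ℝ := (t - τ₁) / lam / a⁻¹ with hu
  have htτ : τ₁ ≤ t := hτc₀.trans htc₀.le
  have huI : u ∈ Icc 0 s' := by
    rw [hu, hs']
    refine ⟨div_nonneg (div_nonneg (by linarith) hlam0.le) (inv_pos.mpr ha).le, ?_⟩
    exact div_le_div_of_nonneg_right (div_le_div_of_nonneg_right (by linarith [ht.2]) hlam0.le) (inv_pos.mpr ha).le
  have hid : lam * (a⁻¹ * u) = t - τ₁ := by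
    rw [hu]; field_simp
  have hval : scaleFam a⁻¹ (fun j m v => translateFam τ₁ S j (m + 1) (lam * v)) i (k - 1) u = a⁻¹ * S i k t := by
    simp only [scaleFam, translateFam, sub_add_cancel, hid, add_sub_cancel]
  have hYb := hY u huI i (k - 1)
  rw [hval, abs_mul, abs_of_pos (inv_pos.mpr ha)] at hYb
  -- `ω_k |S| = a · (ω_k/ω_{k−1}) · ω_{k−1} a⁻¹|S| ≤ a_max Λ_ω B'`
  have h1 : ω k * |S i k t| = a * (ω k * (a⁻¹ * |S i k t|)) := by field_simp
  rw [h1]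
  calc a * (ω k * (a⁻¹ * |S i k t|)) ≤ a * (Λω * (ω (k - 1) * (a⁻¹ * |S i k t|))) := by
        apply mul_le_mul_of_nonneg_left _ ha.le
        calc ω k * (a⁻¹ * |S i k t|) ≤ Λω * ω (k - 1) * (a⁻¹ * |S i k t|) :=
              mul_le_mul_of_nonneg_right (hωup k) (mul_nonneg (inv_pos.mpr ha).le (abs_nonneg _))
          _ = Λω * (ω (k - 1) * (a⁻¹ * |S i k t|)) := by ring
    _ ≤ amax * (Λω * B') := by
        have hin : 0 ≤ ω (k - 1) * (a⁻¹ * |S i k t|) := mul_nonneg (hω0 _) (mul_nonneg (inv_pos.mpr ha).le (abs_nonneg _))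
        exact mul_le_mul haamax (mul_le_mul_of_nonneg_left hYb hΛω) (mul_nonneg hΛω hin) hamax.le
    _ = amax * Λω * B' := by ring
    _ ≤ Bf := hBf2

end Extend

end Summit.NavierStokesRegularity.NavierStokesRegularity.Theorems.HopTube

end
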